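import Summits.BirchSwinnertonDyer.BirchSwinnertonDyer.Theorems.KimAtThreeShallowEqDeepPortItem
import Summits.BirchSwinnertonDyer.BirchSwinnertonDyer.Theorems.KimAtThreeDeepLowerOffStratumAdditiveDefectPortTwoExp
import HarnessLib

/-!
# Route `KimAtThreeKolyvagin` (rung W2), crux `DeepLowerAtThree` (item 19075) and its child
# `DeepLowerAtThreeOffKatoStratum` (item 19679): BOTH BY NAME on EVERY `3`-adic-tower row — the rows with a local
# `3`-torsion point (`#E(ℚ₃)[3] = 3^t`, `t ≥ 1`) included — from PUBLISHED named facts + ONE Kato–Kurihara port text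

Cell `bsd-addord`, seat `bsd-addord-w2-c2` (gen 6, owner of 19679; `--supports stmt-BirchSwinnertonDyer-19075`).
HONEST FRAMING. TOOL theorems only (no definition, no named fact, no `sorry`); nothing asserted about any curve,
nothing booked, no mark moved; items 19075 / 19679 stay OPEN (every theorem concluding a route decl here does so
UNDER HYPOTHESES); BSD is not proved by any of this.  CONDITIONAL, by hypothesis, on PUBLISHED named facts —
[S24] Thm. 4.4 (1)(2) `hS24`/`hS24₂` (Sakamoto 2024, PINNED Literature facts; NOT the S24-DEEP ports), GZK
`hGZK`, Poitou–Tate `hPT`, Carayol `hlev` — and on ONE displayed Kato–Kurihara port text (FLAG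
`K22-Thm3.13-PORT@3`, the cell's single W2 debt class; NOT in print at `3`: Kim, AJM 148 Thm. 3.13 is `p ≥ 5`).

WHY.  The W2 residual of record (plan g18 rev 13; w2-c4 g7 `KimAtThreeShallowEqDeepPortSeam` / `…PortItem`)
reads «PUB + ONE port» on the `E(ℚ₃)[3] = 0` rows only (w2-c4's unlocked port has the `t`-slot `0` and the
binder `#E(ℚ₃)[3] = 1`: `deepLowerOff_torsionFree_of_portOff`), while the cruxes `DeepLowerAtThree` (19075) and
`DeepLowerAtThreeOffKatoStratum` (19679) also quantify over the tower rows WITH a local `3`-torsion point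
(`#E(ℚ₃)[3] = 3^t`, `t ≥ 1`), where this seat's END assembly of record (gen 5, `…OffKatoStratumAssemblyEnd`)
still displays the S24-DEEP ports (FLAG `S24-DEEP-PORT@3`, acc3's deep-family road, (R₁) of
`…AdditiveDefectTorsionSplit`) on the additive rows and the corner residuals (L_ss)/(L_m)/(LL) on the others.
Kim's printed value law (AJM 148 Thm. 3.13, `p ≥ 5`) is `ι ∘ exp*_ω ∘ loc^s_p(κ^{Kato}_n) = u · p^t · δ̃_n ∈
ℤ_p/I_nℤ_p` for EVERY `n ∈ 𝒩_1` — the `p^t` sits on the Kurihara side and NO deeper Frobenius class is needed —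
so the faithful `p = 3` port on a `t`-row is w2-c4's unlocked text with the `t`-slot `t` (guards `k k` / `k′ k′`:
PINNED classes).  With it, acc6's unlocked END (`…nested_twoExp_unlocked W t e k`, which IS `t`-general;
certificate at `n ∈ 𝒩_{k+1}`, modulus `3^j`, `t + j ≤ k + 1`) runs on the PINNED shared-`η` tower family
`TowerPackage.exists_towerFamily_with hS24 hS24₂` — NO deep family, NO S24-DEEP port, NO good core vertex — and
acc3's descent `deepLower_datum_of_plusSymbolEndShapeBound` (at `K = t + 1`) gives the LOWER row.

WHAT.  §1 `padicValRat_ratPlusSymbol_le_of_towerSurj_twoExp_unlocked_tors_with_depth` — w2-c4 g7's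
`…UnlockedTower.padicValRat_ratPlusSymbol_le_of_towerSurj_twoExp_unlocked_with_depth` with the `t`-slot `t` (proof
text verbatim; credit w2-c4 g7 / acc6 / kim3 / cell b2b-bsdres n1011).  §2 `deepLower_row_of_portUnlocked_tors` —
the LOWER row (= the conclusion of 19075 / 19679) at ANY tower row with the datum at the conductor, ANY `t`.  §3
the port as ONE `t`-indexed TEXT in the route file's vocabulary: PORT@3-TORS-OFF (`hPortTorsOff` = w2-c4's
PORT@3-OFF text with `#E(ℚ₃)[3] = 1` replaced by `∀ t, #E(ℚ₃)[3] = 3^t →` and the `t`-slot `t`; at `t = 0`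
(`3^0 = 1`) it IS w2-c4's text, so nothing new is asked on the `E(ℚ₃)[3] = 0` rows) and PORT@3-TORS-ALL (no
off-stratum antecedent); **`deepLowerAtThreeOffKatoStratum_of_portTorsOff`** (crux 19679 BY NAME ⟸ [S24] (1)(2), GZK, PT,
port), **`deepLowerAtThree_of_sharedParts_of_portTorsOff`** (crux 19075 BY NAME ⟸ alias 19678 ∧ port, via the
CLOSED glue 19680), **`deepLowerAtThree_of_pub_of_portTorsAll`** (crux 19075 BY NAME ⟸ the route's four
published leaves ∧ PORT@3-TORS-ALL; no Kato-stratum split, no PORT″: kim3's optimal-datum reduction).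
NET: the residual of 19075 / 19679 is EXACTLY the one debt class K22-Thm3.13-PORT@3 on every row (no S24-DEEP,
no (L_ss)/(L_m)/(LL), no TamDiv).  References: [Kim2022StructureSelmer] Thm. 1.9 (6), 3.13, Lemma 3.3/3.8/3.10;
[Kim2025RefinedTNC] Thm 1.1/1.2, §4.2; [Sakamoto2024] Thm. 4.4; [MazurRubin2004] Thm. 3.2.4, 4.4.1, 5.2.12, App. A
(33); [Kato2004Asterisque] Thm. 12.5 (1); [MilneADT2006] I Thm. 4.10; [Carayol1986]; [EdixhovenManin1991] Prop. 2.
-/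

set_option autoImplicit false
-- the Theorems namespace of a single-conjunct summit repeats the summit name by design (D-0017)
set_option linter.dupNamespace false

noncomputable section

open scoped Classical NumberField ContRepresentation
open Function Field NumberField IsDedekindDomain IsDedekindDomain.HeightOneSpectrum WeierstrassCurve
  CongruenceSubgroup
  Literature.NumberTheory.EllipticCurves Literature.NumberTheory.EllipticCurves.ModularForms
  Literature.NumberTheory.EllipticCurves.Rank1Residual
  Literature.NumberTheory.GaloisRepresentations
  Literature.NumberTheory.GaloisRepresentations.DiscreteGaloisModule Literature.NumberTheory.GaloisCohomology
  Rat.HeightOneSpectrum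
  Summit.BirchSwinnertonDyer.Rank1Residual.GaloisImage
  Summit.BirchSwinnertonDyer.Rank1Residual.GaloisImage.Assembly
  Summit.BirchSwinnertonDyer.Rank1Residual.X4

namespace Summit.BirchSwinnertonDyer.BirchSwinnertonDyer.Theorems.KimAtThreeDeepLowerPortTorsion

open Summit.BirchSwinnertonDyer.BirchSwinnertonDyer.Theses.KimAtThreeKolyvagin
  Summit.BirchSwinnertonDyer.BirchSwinnertonDyer.Theorems.KimAtThreeKolyvaginDefs
  Summit.BirchSwinnertonDyer.BirchSwinnertonDyer.Theorems.KimAtThreeShallowEqDeepUnlockedEndProduct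
  Summit.BirchSwinnertonDyer.BirchSwinnertonDyer.Theorems.KimAtThreeShallowEqDeepUnlockedTower
  Summit.BirchSwinnertonDyer.BirchSwinnertonDyer.Theorems.KimAtThreeKolyvaginDeepLowerKatoStratum
  Summit.BirchSwinnertonDyer.BirchSwinnertonDyer.Theorems.KimAtThreeKolyvaginUnitLevelOneRungs
  Summit.BirchSwinnertonDyer.BirchSwinnertonDyer.Theorems.KimAtThreeKolyvaginCertificateDictionary
  Summit.BirchSwinnertonDyer.BirchSwinnertonDyer.Theorems.KimAtThreeDeepLowerKatoStratumOfFacts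
  Summit.BirchSwinnertonDyer.BirchSwinnertonDyer.Theorems.KimAtThreeShallowEqDeepSplitGlueNoStub
  Summit.BirchSwinnertonDyer.BirchSwinnertonDyer.Theorems.KimAtThreeKolyvaginIsogenyCruxes
  Summit.BirchSwinnertonDyer.BirchSwinnertonDyer.Theorems.KimAtThreeDeepLowerSplitGlueItem
  Summit.BirchSwinnertonDyer.BirchSwinnertonDyer.Theorems.KimAtThreeDeepLowerOffStratumAdditiveDefectPortTwoExp

/-! ### §1 Cor C-t at every depth, `t`-slot `t`, ONE UNLOCKED port (pinned classes; no deep family) -/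

/-- **Cor C-t, every depth, TWO-EXPONENT form, `[0]⁺_f`-currency, UNLOCKED port at `t`-slot `t`** — the
`t`-general twin of w2-c4 g7's
`KimAtThreeShallowEqDeepUnlockedTower.padicValRat_ratPlusSymbol_le_of_towerSurj_twoExp_unlocked_with_depth`:
`W/ℚ` globally minimal, ANY reduction at `3`, the `3`-adic tower onto, a datum `D` with `[0]⁺_{D.f} ≠ 0` (ANY
Manin constant, NO period transfer, NO hypothesis on `#E(ℚ₃)[3]`); `hS24`/`hS24₂` (PINNED), GZK, the
Poitou–Tate families; ONE port (UNLOCKED two-depth witness clauses for the shared `η`, any `e`, `t`-slot `t`,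
guards `k k` / `k′ k′` = the PINNED classes — Kim AJM Thm. 3.13 reads `u · p^t · δ̃_n` at every `n ∈ 𝒩_1`); a
minimal certificate at a cyclic `n ∈ 𝒩_{k+1}(E,3)` (`ℓ ∤ N`, `ψ ↠ ℤ/3^j`, `δ̃^{(j)}_n(ψ) ≠ 0`) with
`t + j ≤ k + 1` ⟹ `ord₃ [0]⁺_{D.f} ≤ ord₃ #Ш(E)(3) + (j − 1)`.  Proof text = w2-c4's (credit w2-c4 g7, acc6,
kim3, n1011: admissible `T`, PINNED shared-`η` tower family, nesting above `k`, acc6's `t`-general unlocked END).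
[cite: Kim2022StructureSelmer, Thm. 1.9 (6) and Thm. 3.13 (arXiv p. 17)] [cite: Sakamoto2024, Thm. 4.4 (p. 926)]
[cite: MazurRubin2004, Thm. 3.2.4, Thm. 4.4.1 and App. A (33)] [cite: MilneADT2006, I §2 Thm 2.8 (p. 31)] -/
theorem padicValRat_ratPlusSymbol_le_of_towerSurj_twoExp_unlocked_tors_with_depth
    (hS24 : Sakamoto2024.kolyvaginSystems_freeRankOne_zmod_three_pow)
    (hS24₂ : Sakamoto2024.kolyvaginSystems_idealOfBasis_eq_fittingIdeal_zmod_three_pow)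
    (hGZK : rank_eq_analyticRank_of_analyticRank_le_one)
    (W : WeierstrassCurve ℚ) [W.IsElliptic] [W.IsGloballyMinimal]
    (htower : ∀ m : ℕ, W.HasSurjectiveModNGaloisRep (3 ^ m : ℕ))
    {N : ℕ} [NeZero N] (D : ModularParametrizationData W N) (h0 : ratPlusSymbol D.f 0 ≠ 0) (t e : ℕ)
    (inv : LocalInvariants ℚ 3) (hperf : inv.IsPerfect) (hsum : inv.SumLocalTermEqZero)
    (hcompl : inv.SelmerComplement)
    (inv' : ∀ k' : ℕ, LocalInvariants ℚ (3 ^ (k' + 1))) (hperf' : ∀ k', (inv' k').IsPerfect)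
    (hsum' : ∀ k', (inv' k').SumLocalTermEqZero) (hcompl' : ∀ k', (inv' k').SelmerComplement)
    (hinj' : ∀ k', ∀ v : HeightOneSpectrum (𝓞 ℚ), Injective (inv' k' (Sum.inr v)))
    (v₃ : HeightOneSpectrum (𝓞 ℚ)) (hv₃ : ((3 : ℕ) : 𝓞 ℚ) ∈ v₃.asIdeal)
    (η : (q : HeightOneSpectrum (𝓞 ℚ)) → (ZMod (Ideal.absNorm q.asIdeal))ˣ)
    (hη : ∀ q : HeightOneSpectrum (𝓞 ℚ), Subgroup.zpowers (η q) = ⊤)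
    (hPort : ∀ (k k' : ℕ) (Dk : KolyvaginDatum (W.torsionGaloisModule (((3 : ℕ) : ℤ) ^ k * ((3 : ℕ) : ℤ))))
      (Dk' : KolyvaginDatum (W.torsionGaloisModule (((3 : ℕ) : ℤ) ^ k' * ((3 : ℕ) : ℤ))))
      (red : (W.torsionGaloisModule (((3 : ℕ) : ℤ) ^ k' * ((3 : ℕ) : ℤ))).toContRepresentation →ⁱL
        (W.torsionGaloisModule (((3 : ℕ) : ℤ) ^ k * ((3 : ℕ) : ℤ))).toContRepresentation),
      Dk.IsCanonicalTauDatumThreeAtWith W k k η → Dk'.IsCanonicalTauDatumThreeAtWith W k' k' η → k ≤ k' →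
      (∀ x : geomTorsion W (((3 : ℕ) : ℤ) ^ k' * ((3 : ℕ) : ℤ)),
        ((red x : geomTorsion W (((3 : ℕ) : ℤ) ^ k * ((3 : ℕ) : ℤ))) : geomPoints W) =
          (((3 : ℕ) : ℤ) ^ (k' - k)) • (x : geomPoints W)) →
      ∃ κ Λ κ' κu Λu κu',
        KatoKuriharaWitnessAtTwoExp W k t e Dk v₃ D κ Λ κ' ∧
        KatoKuriharaWitnessAtTwoExp W k' t e Dk' v₃ D κu Λu κu' ∧
        ∀ d, Dk'.IsLevel d → Dk.IsLevel d →
          galoisCohomology.map red 1 (κu d) = κ d ∧ galoisCohomology.map red 1 (κu' d) = κ' d)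
    (k : ℕ) (n : ℕ) [NeZero n] (hn : Kato.IsKolyvaginProduct W 3 (k + 1) n)
    (hcyc : ∀ (ℓ : ℕ) [Fact ℓ.Prime], ℓ ∣ n →
      Nat.card {P : ((integralModelInt W).map (Int.castRingHom (ZMod ℓ))).toAffine.Point //
        3 • P = 0} ≤ 3)
    (hnN : ∀ ℓ ∈ n.primeFactors, ¬ ℓ ∣ N) {j : ℕ} (htj : t + j ≤ k + 1)
    (ψ : (ℓ : ℕ) → (ZMod ℓ)ˣ →* Multiplicative (ZMod (3 ^ j)))
    (hψ : ∀ ℓ ∈ n.primeFactors, Function.Surjective (ψ ℓ))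
    (hcert : kuriharaNumber D.f (3 ^ j) n ψ ≠ 0)
    (hv : ∀ d : ℕ, d ∣ n → 1 < d → d < n → ∀ [NeZero d], kuriharaNumber D.f (3 ^ j) d ψ = 0) :
    padicValRat 3 (ratPlusSymbol D.f 0) ≤
      (padicValNat 3 (Nat.card (AddCommGroup.primaryComponent W.sha 3)) : ℤ) + ((j - 1 : ℕ) : ℤ) := by
  haveI : Fact (Nat.Prime 3) := ⟨Nat.prime_three⟩
  have hL : W.entireLFunction 1 ≠ 0 := D.isNewformOf.entireLFunction_one_ne_zero_of_ratPlusSymbol_zero_ne_zero h0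
  have hr : W.analyticRank = 0 := analyticRank_eq_zero_of_entireLFunction_one_ne_zero W hL
  have hGZ := hGZK W (by rw [hr]; exact zero_le_one)
  haveI : Finite W.sha := hGZ.2
  haveI : Finite W.toAffine.Point := W.mordellWeilRank_eq_zero_iff_holds.mp (by rw [hGZ.1, hr])
  have hsurj : W.HasSurjectiveModNGaloisRep ((3 : ℕ) : ℤ) := by simpa using htower 1
  have hsurjK : W.HasSurjectiveModNGaloisRep (((3 : ℕ) : ℤ) ^ k * ((3 : ℕ) : ℤ)) := by
    simpa only [Nat.cast_pow, Nat.cast_mul, pow_succ] using htower (k + 1)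
  have hEP : ∀ v : HeightOneSpectrum (𝓞 ℚ), localEulerPoincareCharacteristic (v.adicCompletion ℚ) :=
    localEulerPoincareCharacteristic_rat
  obtain ⟨T, h3T, hbadT, hTmem, hT, h𝓕T, h𝓚T, hfinT, hfinS⟩ := TowerPackage.towerAdmissible W
  have hS : ∀ w : InfinitePlace ℚ, (Sum.inl w : Place ℚ) ∈ finSupport T := inl_mem_finSupport T
  have h3S : ∀ v : HeightOneSpectrum (𝓞 ℚ), ((3 : ℕ) : 𝓞 ℚ) ∈ v.asIdeal →
      (Sum.inr v : Place ℚ) ∈ finSupport T := fun v hv => (inr_mem_finSupport_iff T v).mpr (h3T v hv)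
  have hbadS : ∀ v : HeightOneSpectrum (𝓞 ℚ), ¬ W.HasGoodReductionAt v →
      (Sum.inr v : Place ℚ) ∈ finSupport T := fun v hv => (inr_mem_finSupport_iff T v).mpr (hbadT v hv)
  have hSgood : ∀ v ∉ {v : HeightOneSpectrum (𝓞 ℚ) | (Sum.inr v : Place ℚ) ∈ finSupport T},
      W.HasGoodReductionAt v ∧ ((3 : ℕ) : 𝓞 ℚ) ∉ v.asIdeal := fun v hv =>
    ⟨by_contra fun h => hv (hbadS v h), fun h => hv (h3S v h)⟩
  have hSmem : ∀ v ∈ {v : HeightOneSpectrum (𝓞 ℚ) | (Sum.inr v : Place ℚ) ∈ finSupport T},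
      ¬ W.HasGoodReductionAt v ∨ ((3 : ℕ) : 𝓞 ℚ) ∈ v.asIdeal := fun v hv =>
    hTmem v ((inr_mem_finSupport_iff T v).mp hv)
  obtain ⟨τ, D', g', hτμ, hτq, hP', hDT', hD', hg', hgo', hgen', hR22', hUT', hPS', -⟩ :=
    TowerPackage.exists_towerFamily_with W hS24 hS24₂ htower inv hperf hsum hcompl hEP (finSupport T) hS
      h3S hbadS η hη
  choose red hred using fun k' => exists_torsionReduction_three W k k'
  have hDk : ∀ k', (D' k').IsCanonicalTauDatumThreeAtWith W k' k' η := fun k' =>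
    isCanonicalTauDatumThreeAtWith_of_primes_eq hSgood (hτμ k') (hτq k') (hP' k') (hDT' k') (hD' k')
  have hdict : ∀ k', k ≤ k' → ∃ κ Λ κ' κu Λu κu',
      KatoKuriharaWitnessAtTwoExp W k t e (D' k) v₃ D κ Λ κ' ∧
      KatoKuriharaWitnessAtTwoExp W k' t e (D' k') v₃ D κu Λu κu' ∧
      ∀ d, (D' k').IsLevel d → (D' k).IsLevel d →
        galoisCohomology.map (red k') 1 (κu d) = κ d ∧ galoisCohomology.map (red k') 1 (κu' d) = κ' d :=
    fun k' hk => hPort k k' (D' k) (D' k') (red k') (hDk k) (hDk k') hk (hred k')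
  have hPPk : ∀ k', k ≤ k' → (D' k').primes ⊆ (D' k).primes := fun k' hk' => by
    rw [hP' k', hP' k]
    exact FrobShape.frobeniusClassPrimes_pow_mul_subset_of_le W 3 hk' hsurjK (hτμ k) (hτq k) (hτμ k')
      (hτq k') _
  exact padicValRat_ratPlusSymbol_le_of_kolyvaginProduct_of_card_torsion_le_nested_twoExp_unlocked W t e k
    (D' k) v₃ hv₃ hsurj D h0 (hDT' k) (g' k) (hg' k) (hgen' k) D' hDT'
    hPPk red hred hdict g' hg' hgo' hgen' inv' hperf' hsum' hcompl' hinj' hEP (fun _ => T)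
    (fun _ => h3T v₃ hv₃) hT h𝓕T h𝓚T hfinT hfinS
    (fun q hq => fun h => hPS' k q hq ((inr_mem_finSupport_iff T q).mpr h))
    (fun k' q hq => fun h => hPS' k' q hq ((inr_mem_finSupport_iff T q).mpr h))
    (hUT' k) hUT'
    (fun d hd => hR22' k (inv' k) (hperf' k) (hsum' k) (hcompl' k) d hd)
    (fun k' d hd => hR22' k' (inv' k') (hperf' k') (hsum' k') (hcompl' k') d hd)
    hSmem (hτμ k) (hτq k) (hP' k) hsurjK n hn hcyc hnN (j := j) htj ψ hψ hcert hv

/-! ### §2 The LOWER row of 19075 / 19679 at ANY tower row (any `t`) from PUB + the unlocked port -/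

/-- **LOWER row (cruxes 19075 / 19679) at ANY tower row with the datum at the conductor, ANY local `3`-torsion
exponent `t` in the port's value law: `∃ d, ∂^{(∞)}_deep = d ∧ ∂⁽⁰⁾ ≤ ord₃ #Ш(3) + d`** from [S24] (1)(2) PINNED,
GZK, Poitou–Tate and the unlocked port at `t`-slot `t` (NO S24-DEEP port, NO reduction-type / Tamagawa / Manin /
period binder).  Proof: acc3 g2's descent `deepLower_datum_of_plusSymbolEndShapeBound` at `K = t + 1` over §1 at
depth `k = L − 1` (certificate at a cyclic `n ∈ 𝒩_L(E,3)`, modulus `3^{j′}`, `t + j′ ≤ L`); `ℓ ∤ N` for `ℓ ∣ n`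
because `N` is the conductor and `ℓ` is a good prime.
[cite: Kim2022StructureSelmer, Thm. 1.9 (6), Thm. 3.13 (arXiv p. 17), §1.5.1] [cite: Kim2025RefinedTNC, Thm 1.1]
[cite: Sakamoto2024, Thm. 4.4 (p. 926)] [cite: MazurRubin2004, Def. 5.2.11, Thm. 5.2.12 (i)]
[cite: MilneADT2006, Ch. I, Thm. 4.10] -/
theorem deepLower_row_of_portUnlocked_tors
    (hS24 : Sakamoto2024.kolyvaginSystems_freeRankOne_zmod_three_pow)
    (hS24₂ : Sakamoto2024.kolyvaginSystems_idealOfBasis_eq_fittingIdeal_zmod_three_pow)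
    (hGZK : rank_eq_analyticRank_of_analyticRank_le_one) (hPT : poitouTate_selmerStructure_duality ℚ)
    (W : WeierstrassCurve ℚ) [W.IsElliptic] [W.IsGloballyMinimal]
    (htower : ∀ m : ℕ, W.HasSurjectiveModNGaloisRep (3 ^ m : ℕ))
    {N : ℕ} [NeZero N] (hN : N = W.conductorNorm ℤ) (D : ModularParametrizationData W N) (t e : ℕ)
    (hord : kuriharaVanishingOrder W 3 D.f = 0)
    (v₃ : HeightOneSpectrum (𝓞 ℚ)) (hv₃ : ((3 : ℕ) : 𝓞 ℚ) ∈ v₃.asIdeal)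
    (η : (q : HeightOneSpectrum (𝓞 ℚ)) → (ZMod (Ideal.absNorm q.asIdeal))ˣ)
    (hη : ∀ q : HeightOneSpectrum (𝓞 ℚ), Subgroup.zpowers (η q) = ⊤)
    (hPort : ∀ (k k' : ℕ) (Dk : KolyvaginDatum (W.torsionGaloisModule (((3 : ℕ) : ℤ) ^ k * ((3 : ℕ) : ℤ))))
      (Dk' : KolyvaginDatum (W.torsionGaloisModule (((3 : ℕ) : ℤ) ^ k' * ((3 : ℕ) : ℤ))))
      (red : (W.torsionGaloisModule (((3 : ℕ) : ℤ) ^ k' * ((3 : ℕ) : ℤ))).toContRepresentation →ⁱL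
        (W.torsionGaloisModule (((3 : ℕ) : ℤ) ^ k * ((3 : ℕ) : ℤ))).toContRepresentation),
      Dk.IsCanonicalTauDatumThreeAtWith W k k η → Dk'.IsCanonicalTauDatumThreeAtWith W k' k' η → k ≤ k' →
      (∀ x : geomTorsion W (((3 : ℕ) : ℤ) ^ k' * ((3 : ℕ) : ℤ)),
        ((red x : geomTorsion W (((3 : ℕ) : ℤ) ^ k * ((3 : ℕ) : ℤ))) : geomPoints W) =
          (((3 : ℕ) : ℤ) ^ (k' - k)) • (x : geomPoints W)) →
      ∃ κ Λ κ' κu Λu κu',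
        KatoKuriharaWitnessAtTwoExp W k t e Dk v₃ D κ Λ κ' ∧
        KatoKuriharaWitnessAtTwoExp W k' t e Dk' v₃ D κu Λu κu' ∧
        ∀ d, Dk'.IsLevel d → Dk.IsLevel d →
          galoisCohomology.map red 1 (κu d) = κ d ∧ galoisCohomology.map red 1 (κu' d) = κ' d) :
    ∃ d : ℕ, kuriharaPartialDeepInfty W 3 D.f = d ∧
      kuriharaPartial W 3 D.f 0 ≤
        ((padicValNat 3 (Nat.card (AddCommGroup.primaryComponent W.sha 3)) + d : ℕ) : ℕ∞) := by
  haveI : Fact (Nat.Prime 3) := ⟨Nat.prime_three⟩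
  have h0 : ratPlusSymbol D.f 0 ≠ 0 :=
    ratPlusSymbol_zero_ne_zero_of_kuriharaVanishingOrder_eq_zero W 3 D.f hord
  obtain ⟨inv, hperf, hsum, -, hcompl⟩ := hPT 3
  obtain ⟨inv', hperf', hsum', hcompl', hinj'⟩ := exists_localInvariants_three_pow_of_poitouTate hPT
  refine deepLower_datum_of_plusSymbolEndShapeBound W htower D hord (t + 1) ?_
  intro j' L n hj' hKL hcyc hLn ψ hψ hne hv
  haveI : NeZero n := ⟨hLn.ne_zero⟩
  have hL : L - 1 + 1 = L := by omega
  have hn' : Kato.IsKolyvaginProduct W 3 (L - 1 + 1) n := by rw [hL]; exact hLn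
  exact padicValRat_ratPlusSymbol_le_of_towerSurj_twoExp_unlocked_tors_with_depth hS24 hS24₂ hGZK W htower D
    h0 t e inv hperf hsum hcompl inv' hperf' hsum' hcompl' hinj' v₃ hv₃ η hη hPort (L - 1) n hn'
    (fun ℓ _ hℓ => hcyc.2 ℓ hℓ) (fun ℓ hℓ hℓN => (hLn.2 ℓ hℓ).not_dvd_conductorNorm (hN ▸ hℓN))
    (j := j') (by omega) ψ hψ hne hv

/-! ### §3 The port as ONE `t`-indexed text; cruxes 19679 and 19075 BY NAME -/

section PortTorsOff

/- PORT@3-TORS-OFF: w2-c4 g7's PORT@3-OFF text (`KimAtThreeShallowEqDeepPortSeam`, `hPortOff`) with the binder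
`#E(ℚ₃)[3] = 1` replaced by `∀ t, #E(ℚ₃)[3] = 3^t →` and the value law's `t`-slot `0` replaced by `t`. -/
variable
  (hPortTorsOff : ∀ (W₀ : WeierstrassCurve ℚ) [W₀.IsElliptic] [W₀.IsGloballyMinimal],
    (∀ n : ℕ, W₀.HasSurjectiveModNGaloisRep (3 ^ n : ℕ)) →
    ∀ (t : ℕ), Nat.card {Q : (W₀.baseChange ℚ_[3]).toAffine.Point // (3 : ℕ) • Q = 0} = 3 ^ t →
    ∀ (v₃ : HeightOneSpectrum (𝓞 ℚ)), ((3 : ℕ) : 𝓞 ℚ) ∈ v₃.asIdeal →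
    ∀ (η : (q : HeightOneSpectrum (𝓞 ℚ)) → (ZMod (Ideal.absNorm q.asIdeal))ˣ),
      (∀ q, Subgroup.zpowers (η q) = ⊤) →
    ∀ {N : ℕ} [NeZero N] (P : ModularParametrizationData W₀ N), N = W₀.conductorNorm ℤ →
      (∀ z ∈ P.L.lattice, ∃ w ∈ periodLattice P.f, z = P.c * w) →
      ¬ ((haveI : Fact (Nat.Prime 3) := ⟨Nat.prime_three⟩; Addv W₀ 3) ∧
          ¬ 3 ∣ (W₀.baseChange ℚ_[3]).localTamagawaNumber ℤ_[3] ∧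
          Nat.card {Q : (W₀.baseChange ℚ_[3]).toAffine.Point // (3 : ℕ) • Q = 0} = 1 ∧
          ¬ (3 : ℤ) ∣ P.maninConstant) →
      ∃ e : ℕ, ∀ (k k' : ℕ)
        (Dk : KolyvaginDatum (W₀.torsionGaloisModule (((3 : ℕ) : ℤ) ^ k * ((3 : ℕ) : ℤ))))
        (Dk' : KolyvaginDatum (W₀.torsionGaloisModule (((3 : ℕ) : ℤ) ^ k' * ((3 : ℕ) : ℤ))))
        (red : (W₀.torsionGaloisModule (((3 : ℕ) : ℤ) ^ k' * ((3 : ℕ) : ℤ))).toContRepresentation →ⁱL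
          (W₀.torsionGaloisModule (((3 : ℕ) : ℤ) ^ k * ((3 : ℕ) : ℤ))).toContRepresentation),
        Dk.IsCanonicalTauDatumThreeAtWith W₀ k k η → Dk'.IsCanonicalTauDatumThreeAtWith W₀ k' k' η → k ≤ k' →
        (∀ x : geomTorsion W₀ (((3 : ℕ) : ℤ) ^ k' * ((3 : ℕ) : ℤ)),
          ((red x : geomTorsion W₀ (((3 : ℕ) : ℤ) ^ k * ((3 : ℕ) : ℤ))) : geomPoints W₀) =
            (((3 : ℕ) : ℤ) ^ (k' - k)) • (x : geomPoints W₀)) →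
        ∃ κ Λ κ' κu Λu κu',
          KatoKuriharaWitnessAtTwoExp W₀ k t e Dk v₃ P κ Λ κ' ∧
          KatoKuriharaWitnessAtTwoExp W₀ k' t e Dk' v₃ P κu Λu κu' ∧
          ∀ d, Dk'.IsLevel d → Dk.IsLevel d →
            galoisCohomology.map red 1 (κu d) = κ d ∧ galoisCohomology.map red 1 (κu' d) = κ' d)

include hPortTorsOff

/-- **Crux 19679 `DeepLowerAtThreeOffKatoStratum` BY NAME — EVERY row, the `t ≥ 1` rows included — ⟸ [S24]
(1)(2) PINNED ∧ GZK ∧ Poitou–Tate ∧ PORT@3-TORS-OFF.**  At a row: `#E(ℚ₃)[3] = 3^t` for some `t`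
(`exists_natCard_threeTorsion_eq_three_pow`), the place above `3` and a generator family
(`exists_place_three_and_generators`), the port's exponent `e`, then §2.  No S24-DEEP port, no corner lower half
(L_ss)/(L_m), no level-lowering (LL), no Tamagawa divisibility, no twin 19562: the residual of 19679 is the ONE
debt class K22-Thm3.13-PORT@3.  CONDITIONAL: does not close the item. [cite: Kim2022StructureSelmer, Thm. 1.9 (6), Thm. 3.13]
[cite: Kim2025RefinedTNC, Thm 1.1] [cite: Sakamoto2024, Thm. 4.4 (p. 926)] [cite: MazurRubin2004, Thm. 5.2.12] -/
theorem deepLowerAtThreeOffKatoStratum_of_portTorsOff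
    (hS24 : Sakamoto2024.kolyvaginSystems_freeRankOne_zmod_three_pow)
    (hS24₂ : Sakamoto2024.kolyvaginSystems_idealOfBasis_eq_fittingIdeal_zmod_three_pow)
    (hGZK : rank_eq_analyticRank_of_analyticRank_le_one) (hPT : poitouTate_selmerStructure_duality ℚ) :
    DeepLowerAtThreeOffKatoStratum := by
  intro W₀ _ _ htow _ N _ hN D₀ hopt _ _ hord hoff
  obtain ⟨t, ht⟩ := exists_natCard_threeTorsion_eq_three_pow W₀
  obtain ⟨v₃, η, hv₃, hη⟩ := exists_place_three_and_generators
  obtain ⟨e, hPort⟩ := hPortTorsOff W₀ htow t ht v₃ hv₃ η hη D₀ hN hopt hoff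
  exact deepLower_row_of_portUnlocked_tors hS24 hS24₂ hGZK hPT W₀ htow hN D₀ t e hord v₃ hv₃ η hη hPort

/-- **Crux 19075 `DeepLowerAtThree` BY NAME ⟸ alias 19678 `KatoStratumSharedParts` ∧ PORT@3-TORS-OFF** — the
CLOSED glue 19680 (`KimAtThreeDeepLowerSplitGlueItem.deepLowerOfParts_proof`: ON the Kato stratum PORT″ = crux
19560, OFF it crux 19679) fed with `deepLowerAtThreeOffKatoStratum_of_portTorsOff` (the alias supplies [S24],
GZK, Poitou–Tate).  CONDITIONAL: does not close the item. [cite: Kim2025RefinedTNC, Thm 1.1]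
[cite: Sakamoto2024, Thm. 4.4 (p. 926)] [cite: MazurRubin2004, Thm. 5.2.12] [cite: Carayol1986] -/
theorem deepLowerAtThree_of_sharedParts_of_portTorsOff (hParts : KatoStratumSharedParts) : DeepLowerAtThree :=
  deepLowerOfParts_proof hParts
    (deepLowerAtThreeOffKatoStratum_of_portTorsOff hPortTorsOff hParts.1.1 hParts.1.2 hParts.2.1 hParts.2.2.1)

end PortTorsOff

section PortTorsAll

/- PORT@3-TORS-ALL: the same text WITHOUT the off-stratum antecedent (`t`-indexed, `∃ e` currency). -/
variable
  (hPortTorsAll : ∀ (W₀ : WeierstrassCurve ℚ) [W₀.IsElliptic] [W₀.IsGloballyMinimal],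
    (∀ n : ℕ, W₀.HasSurjectiveModNGaloisRep (3 ^ n : ℕ)) →
    ∀ (t : ℕ), Nat.card {Q : (W₀.baseChange ℚ_[3]).toAffine.Point // (3 : ℕ) • Q = 0} = 3 ^ t →
    ∀ (v₃ : HeightOneSpectrum (𝓞 ℚ)), ((3 : ℕ) : 𝓞 ℚ) ∈ v₃.asIdeal →
    ∀ (η : (q : HeightOneSpectrum (𝓞 ℚ)) → (ZMod (Ideal.absNorm q.asIdeal))ˣ),
      (∀ q, Subgroup.zpowers (η q) = ⊤) →
    ∀ {N : ℕ} [NeZero N] (P : ModularParametrizationData W₀ N), N = W₀.conductorNorm ℤ →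
      (∀ z ∈ P.L.lattice, ∃ w ∈ periodLattice P.f, z = P.c * w) →
      ∃ e : ℕ, ∀ (k k' : ℕ)
        (Dk : KolyvaginDatum (W₀.torsionGaloisModule (((3 : ℕ) : ℤ) ^ k * ((3 : ℕ) : ℤ))))
        (Dk' : KolyvaginDatum (W₀.torsionGaloisModule (((3 : ℕ) : ℤ) ^ k' * ((3 : ℕ) : ℤ))))
        (red : (W₀.torsionGaloisModule (((3 : ℕ) : ℤ) ^ k' * ((3 : ℕ) : ℤ))).toContRepresentation →ⁱL
          (W₀.torsionGaloisModule (((3 : ℕ) : ℤ) ^ k * ((3 : ℕ) : ℤ))).toContRepresentation),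
        Dk.IsCanonicalTauDatumThreeAtWith W₀ k k η → Dk'.IsCanonicalTauDatumThreeAtWith W₀ k' k' η → k ≤ k' →
        (∀ x : geomTorsion W₀ (((3 : ℕ) : ℤ) ^ k' * ((3 : ℕ) : ℤ)),
          ((red x : geomTorsion W₀ (((3 : ℕ) : ℤ) ^ k * ((3 : ℕ) : ℤ))) : geomPoints W₀) =
            (((3 : ℕ) : ℤ) ^ (k' - k)) • (x : geomPoints W₀)) →
        ∃ κ Λ κ' κu Λu κu',
          KatoKuriharaWitnessAtTwoExp W₀ k t e Dk v₃ P κ Λ κ' ∧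
          KatoKuriharaWitnessAtTwoExp W₀ k' t e Dk' v₃ P κu Λu κu' ∧
          ∀ d, Dk'.IsLevel d → Dk.IsLevel d →
            galoisCohomology.map red 1 (κu d) = κ d ∧ galoisCohomology.map red 1 (κu' d) = κ' d)

include hPortTorsAll

/-- **Crux 19075 `DeepLowerAtThree` BY NAME ⟸ the route's four PUBLISHED leaves ∧ PORT@3-TORS-ALL — no
Kato-stratum split, no PORT″, no alias**: kim3 g9's reduction to lattice-optimal data at the conductor
(`deepLowerAtThree_of_forall_optimalDatum_atConductor`, Carayol `hlev` + isogeny invariance under `E[3]`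
irreducible + Edixhoven's optimal datum), then §2 at the row's `t`, `(v₃, η)` and the port's `e`.  Inputs by the
route's own names: `SakamotoKolyvaginThree` (19558), `RankEqAnalyticRankLeOne` (19921), `PoitouTateSelmerDuality`
(19559), `CarayolLevelEqConductor` (19467).  CONDITIONAL: does not close the item.
[cite: Kim2025RefinedTNC, Thm 1.1] [cite: Kim2022StructureSelmer, Thm. 1.9 (6), Thm. 3.13]
[cite: Sakamoto2024, Thm. 4.4 (p. 926)] [cite: MazurRubin2004, Thm. 5.2.12] [cite: Carayol1986]
[cite: EdixhovenManin1991, Prop. 2] -/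
theorem deepLowerAtThree_of_pub_of_portTorsAll (hSak : SakamotoKolyvaginThree) (hGZK : RankEqAnalyticRankLeOne)
    (hPT : PoitouTateSelmerDuality) (hlev : CarayolLevelEqConductor) : DeepLowerAtThree := by
  refine deepLowerAtThree_of_forall_optimalDatum_atConductor hlev ?_
  intro W₀ _ _ htow _ N _ hN D₀ hopt _ _ hord
  obtain ⟨t, ht⟩ := exists_natCard_threeTorsion_eq_three_pow W₀
  obtain ⟨v₃, η, hv₃, hη⟩ := exists_place_three_and_generators
  obtain ⟨e, hPort⟩ := hPortTorsAll W₀ htow t ht v₃ hv₃ η hη D₀ hN hopt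
  exact deepLower_row_of_portUnlocked_tors hSak.1 hSak.2 hGZK hPT W₀ htow hN D₀ t e hord v₃ hv₃ η hη hPort

/-- **Crux 19679 BY NAME ⟸ [S24] (1)(2) ∧ GZK ∧ Poitou–Tate ∧ PORT@3-TORS-ALL** (drop the off-stratum
antecedent). [cite: Kim2025RefinedTNC, Thm 1.1] [cite: Sakamoto2024, Thm. 4.4 (p. 926)] -/
theorem deepLowerAtThreeOffKatoStratum_of_portTorsAll
    (hS24 : Sakamoto2024.kolyvaginSystems_freeRankOne_zmod_three_pow)
    (hS24₂ : Sakamoto2024.kolyvaginSystems_idealOfBasis_eq_fittingIdeal_zmod_three_pow)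
    (hGZK : rank_eq_analyticRank_of_analyticRank_le_one) (hPT : poitouTate_selmerStructure_duality ℚ) :
    DeepLowerAtThreeOffKatoStratum :=
  deepLowerAtThreeOffKatoStratum_of_portTorsOff
    (fun W₀ _ _ htow t ht v₃ hv₃ η hη _ _ P hN hopt _ => hPortTorsAll W₀ htow t ht v₃ hv₃ η hη P hN hopt)
    hS24 hS24₂ hGZK hPT

end PortTorsAll

end Summit.BirchSwinnertonDyer.BirchSwinnertonDyer.Theorems.KimAtThreeDeepLowerPortTorsion

end

/-! ## ERRATUM (w2-c2 gen 6, 2026-08-27T02:45Z, append-only; no declaration changed)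

The module docstring's sentence «the faithful `p = 3` port on a `t`-row is w2-c4's unlocked text with the
`t`-slot `t` (guards `k k` / `k′ k′`: PINNED classes)» and the reading «n1011's (B6) guards `k + t` / acc1's depth
shift 2 are DISCHARGER conveniences, not part of the printed law» are WITHDRAWN.  [MR04] App. A, Prop. A.2
(pp. 79–80): when `H⁰(ℚ_p, T*)` is not divisible — for `T₃E`: `E(ℚ₃)[3] ≠ 0`, i.e. `t ≥ 1` — the derivative
classes `κ_n^{(k)}` satisfy the CANONICAL local condition at `p` only for `n ∈ 𝒩_j` with `j` beyond the stable
range («`𝓕(ℚ_p, T/m^k)` is the image of `H¹(ℚ_p, T/m^j)` for `j ≫ 0`; for `n ∈ 𝒩_j`, `I_n ⊂ m^j`»); the tree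
has it with the level explicit (n1011 T-DER-BP, `PropagatedConditionStableRangeThree`:
`im red_N = 𝓕_can(E[3^{k+1}])₃` iff `N ≥ N₀`, the torsion-stable level of `E(ℚ₃)`), and Kim AJM 148 Thm. 3.13 is
stated on `Sel_{rel,n}` (relaxed at `p`, extended `exp*` of §3.3.2) for the same reason.  So at `t ≥ 1` clause (0)
of `KatoKuriharaWitnessAt[TwoExp]` (Selmer membership for `𝓕_can` PROPAGATED at `3`) is supported by print ONLY
on data whose primes lie in the class of depth `k + N₀` — the DEEP guards of n1011's PORT″ / acc6's PORT₂ — and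
the pinned-guard `t`-slot-`t` port hypothesis of this file (`hPort` of §1–§2 at `t ≥ 1`, `hPortTorsOff` /
`hPortTorsAll` at `t ≥ 1`) OVER-ASKS: it is not known to follow from Kato's Euler system, may fail on rows where
some pinned level's class does not lift at `3`, and must NOT be registered as an item text.  Every theorem here
remains a valid kernel statement; at `t = 0` (`#E(ℚ₃)[3] = 1`, `N₀ = 0`) the hypothesis IS w2-c4 g7's PORT@3-OFF
/ -ALL and nothing changes.  The `t ≥ 1` rows' road of record stays acc3's (R₁)
(`KimAtThreeDeepLowerOffStratumAdditiveDefectTorsionSplit.torsionRows_of_deepPortsTwoExp`: deep-guard PORT₂ +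
S24-DEEP (1)(2)) until the flag-free deep END (`KimAtThreeDeepLowerS24DeepOfPinned` re-key + one port-free good
core vertex per class depth) lands.  [cite: MazurRubin2004, App. A, Lemma A.1 and Prop. A.2 (pp. 79–80)]
[cite: Kim2022StructureSelmer, §3.3.2 and Thm. 3.13 (arXiv p. 17)] -/
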